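import Mathlib
import HarnessLib
import Literature.AlgebraicGeometry.Ramification.InertiaNormalSylow
import Literature.AlgebraicGeometry.Resolution.AugmentationIdeal
import Literature.AlgebraicGeometry.Resolution.StalkIdealLemmas
import Literature.AlgebraicGeometry.Resolution.AlterationsNormalFormBlowupFormal
import Summits.ResolutionOfSingularities.ResolutionOfSingularities.Theorems.WildQuotientsWildQuotientResolutionTameFixedLocus

/-!
# The reduced inert locus of a subgroup: its stalk is the fixed-locus ideal of the stalk action
# (crux `WildQuotients.WildQuotientResolution`, stub `stub_phaseZeroHighDim`; scheme plumbing of tame centres, any dimension)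

Crux stmt-ResolutionOfSingularities-15640 (`WildQuotientResolution`), registered stub `stub_phaseZeroHighDim`.
The all-dimensional tame layer (✓`TameFixedLocus` p817669, ✓`TameCentreStable` p817910, ✓`TameEndState`
p817841 / p819336) works with the fixed-locus ideal `𝔞_K = ⨆_{k ∈ K} I_{τ k} ⊆ 𝒪_{X,x}` of a subgroup `K` of
the inertia group acting on the STALK through `τ` (`PointBlowupStalkData.exists_stalkAction`:
`Spec(a_g) ≫ ι_x = ι_x ≫ ρ g`, `τ g = a_{g⁻¹}`). To blow such a centre up GLOBALLY and `G`-equivariantly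
(✓`CurveStep.curveMove`, ✓`CentreBlowupStalkData`: a `G`-stable ideal SHEAF whose subscheme is regular) one
needs an ideal sheaf on `X` with these stalks. This file identifies it as the vanishing (reduced) ideal sheaf
of the INERT LOCUS `Z_K = {y | K ≤ I_y}` (closed over a separated invariant base, ✓`isClosed_setOf_le_inertia`):

* `mem_inertiaSubgroup_fromSpecStalk_iff` (+ `_of_action`) — **inertia at the generizations of `x`, read on
  the stalk at `x`**: for a point `𝔮` of `Spec 𝒪_{X,x}` with image `y = ι_x(𝔮)` (a generization of `x`) and
  `g` fixing `x`, `g ∈ I_y ↔ (a_g − 1) 𝒪_{X,x} ⊆ 𝔮 ↔ (τ g − 1) 𝒪_{X,x} ⊆ 𝔮` (the `K`-point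
  `Spec κ(𝔮) → Spec 𝒪_{X,x} → X` and AS2011's `I_ȳ = I_y`, ✓`mem_inertiaSubgroup_iff_comp_eq`);
* `fromSpecStalk_mem_inertLocus_iff` — hence `ι_x(𝔮) ∈ Z_K ↔ 𝔞_K ≤ 𝔮`; at the closed point:
  `x ∈ Z_K ↔ 𝔞_K ≤ 𝔪_x` (`mem_inertLocus_iff_iSup_augIdeal_le`);
* `stalkIdeal_vanishingIdeal_inertLocus` — **`(𝓘_{Z_K})_x = √𝔞_K`** for every closed `Z_K` (both sides are
  the intersection of the primes `𝔮` with `ι_x(𝔮) ∈ Z_K`: ✓`fromSpecStalk_mem_iff_stalkIdeal_vanishingIdeal_le`,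
  ✓`stalkIdeal_radical`);
* `stalkIdeal_vanishingIdeal_inertLocus_of_isUnit`, `isRegularLocalRing_quotient_stalkIdeal_inertLocus` — for
  `𝒪_{X,x}` REGULAR and `|K|` invertible in it (tame `K`), `𝔞_K` is prime (✓`TameFixedLocus`: the quotient is
  regular local), so `(𝓘_{Z_K})_x = 𝔞_K` on the nose and `𝒪_{X,x} ⧸ (𝓘_{Z_K})_x` is a regular local ring:
  the reduced inert locus of a tame subgroup is a REGULAR centre at each of its points, with the stalks the
  local theory uses.

[OURS · crux stmt-ResolutionOfSingularities-15640 · helper toward `stub_phaseZeroHighDim` (scheme plumbing of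
the tame centres; NOT a proof of the stub); folklore, counted 0; AI-level work, weaker than expert review.]
[folklore; cf. AbbesSaito2011, 2.4]
-/

-- single-problem summit: the doubled namespace component `ResolutionOfSingularities` is forced
set_option linter.dupNamespace false

noncomputable section

namespace Summit.ResolutionOfSingularities.ResolutionOfSingularities.Theorems.WildQuotientResolution.InertLocusStalk

open CategoryTheory AlgebraicGeometry TopologicalSpace IsLocalRing
open Literature.AlgebraicGeometry.Resolution Literature.AlgebraicGeometry.Ramification

universe u

variable {X : Scheme.{u}} {G : Type*} [Group G] (σ : G →* Aut X) (x : X) {I : Subgroup G}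

/-! ## Inertia at the generizations of `x`, read on `𝒪_{X,x}` -/

/-- **Inertia at a generization, on the stalk.** Let `a_g` (`g ∈ I`, a subgroup fixing `x`) be stalk
endomorphisms of `𝒪_{X,x}` with `Spec(a_g) ≫ ι_x = ι_x ≫ σ g` (`ι_x : Spec 𝒪_{X,x} → X`;
`PointBlowupStalkData.exists_stalkAction`). For a point `𝔮` of `Spec 𝒪_{X,x}`, with image the generization
`y = ι_x(𝔮)` of `x`: `g ∈ I_y` iff `a_g(r) − r ∈ 𝔮` for all `r` — the `κ(𝔮)`-point `Spec κ(𝔮) → X` is centred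
at `y`, and `I_y` is its stabiliser (AS2011 2.4, `I_ȳ = I_y`). [folklore; cf. AbbesSaito2011, 2.4] -/
theorem mem_inertiaSubgroup_fromSpecStalk_iff
    (a : I → (X.presheaf.stalk x ⟶ X.presheaf.stalk x))
    (hkey : ∀ g : I, Spec.map (a g) ≫ X.fromSpecStalk x = X.fromSpecStalk x ≫ (σ (g : G)).hom)
    (𝔮 : Spec (X.presheaf.stalk x)) (g : I) :
    (g : G) ∈ inertiaSubgroup σ ((X.fromSpecStalk x).base 𝔮) ↔
      ∀ r, (a g).hom r - r ∈ 𝔮.asIdeal := by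
  classical
  let K : Type u := 𝔮.asIdeal.ResidueField
  let φ : X.presheaf.stalk x ⟶ CommRingCat.of K :=
    CommRingCat.ofHom (algebraMap (X.presheaf.stalk x) K)
  let pt : Spec (.of K) ⟶ X := Spec.map φ ≫ X.fromSpecStalk x
  have hφ : (Spec.map φ).base (closedPoint K) = 𝔮 := by
    change PrimeSpectrum.comap φ.hom (closedPoint K) = 𝔮
    apply PrimeSpectrum.ext
    rw [PrimeSpectrum.comap_asIdeal]
    change Ideal.comap (algebraMap (X.presheaf.stalk x) K) (maximalIdeal K) = 𝔮.asIdeal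
    rw [IsLocalRing.maximalIdeal_eq_bot, ← RingHom.ker_eq_comap_bot, Ideal.ker_algebraMap_residueField]
  have hpt : pt.base (closedPoint K) = (X.fromSpecStalk x).base 𝔮 := by
    rw [Scheme.Hom.comp_base, TopCat.coe_comp, Function.comp_apply, hφ]
  have h1 : (g : G) ∈ inertiaSubgroup σ ((X.fromSpecStalk x).base 𝔮) ↔ pt ≫ (σ (g : G)).hom = pt := by
    rw [← hpt]
    exact mem_inertiaSubgroup_iff_comp_eq σ pt (g : G)
  rw [h1]
  have h2 : pt ≫ (σ (g : G)).hom = pt ↔ a g ≫ φ = φ := by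
    simp only [pt, Category.assoc]
    rw [← hkey g, ← Spec.map_comp_assoc, cancel_mono, Spec.map_injective.eq_iff]
  rw [h2]
  constructor
  · intro h r
    have h' : φ.hom ((a g).hom r) = φ.hom r := by
      rw [← CommRingCat.comp_apply, h]
    change algebraMap (X.presheaf.stalk x) K ((a g).hom r) = algebraMap (X.presheaf.stalk x) K r at h'
    rw [← Ideal.algebraMap_residueField_eq_zero, map_sub, sub_eq_zero]
    exact h'
  · intro h
    ext r
    have h' := h r
    rw [← Ideal.algebraMap_residueField_eq_zero, map_sub, sub_eq_zero] at h'
    rw [CommRingCat.comp_apply]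
    exact h'

/-- The same for the stalk ACTION `τ : I →* Aut 𝒪_{X,x}`, `τ g = a_{g⁻¹}` (variance corrected, as produced by
`PointBlowupStalkData.exists_stalkAction`): `g ∈ I_{ι_x(𝔮)} ↔ τ g (r) − r ∈ 𝔮` for all `r`.
[folklore; cf. AbbesSaito2011, 2.4] -/
theorem mem_inertiaSubgroup_fromSpecStalk_iff_of_action
    (a : I → (X.presheaf.stalk x ⟶ X.presheaf.stalk x))
    (τ : I →* (X.presheaf.stalk x ≃+* X.presheaf.stalk x))
    (hkey : ∀ g : I, Spec.map (a g) ≫ X.fromSpecStalk x = X.fromSpecStalk x ≫ (σ (g : G)).hom)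
    (hτ : ∀ (g : I) (r : X.presheaf.stalk x), τ g r = (a g⁻¹).hom r)
    (𝔮 : Spec (X.presheaf.stalk x)) (g : I) :
    (g : G) ∈ inertiaSubgroup σ ((X.fromSpecStalk x).base 𝔮) ↔ ∀ r, τ g r - r ∈ 𝔮.asIdeal := by
  have h := mem_inertiaSubgroup_fromSpecStalk_iff σ x a hkey 𝔮 g⁻¹
  rw [Subgroup.coe_inv, inv_mem_iff] at h
  rw [h]
  simp_rw [hτ]

/-! ## The inert locus of a subgroup `K ≤ I` -/

section InertLocus

variable (a : I → (X.presheaf.stalk x ⟶ X.presheaf.stalk x))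
  (τ : I →* (X.presheaf.stalk x ≃+* X.presheaf.stalk x))
  (hkey : ∀ g : I, Spec.map (a g) ≫ X.fromSpecStalk x = X.fromSpecStalk x ≫ (σ (g : G)).hom)
  (hτ : ∀ (g : I) (r : X.presheaf.stalk x), τ g r = (a g⁻¹).hom r)
  {K : Subgroup G} (hK : K ≤ I)

include hkey hτ

/-- **The inert locus near `x`, on the stalk**: for `K ≤ I`, the generization `ι_x(𝔮)` lies in the inert locus
`Z_K = {y | K ≤ I_y}` iff the fixed-locus ideal `𝔞_K = ⨆_{k ∈ K} I_{τ k}` is contained in `𝔮`. [folklore] -/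
theorem fromSpecStalk_mem_inertLocus_iff (𝔮 : Spec (X.presheaf.stalk x)) :
    (X.fromSpecStalk x).base 𝔮 ∈ {y : X | K ≤ inertiaSubgroup σ y} ↔
      (⨆ k : K, augIdeal ((τ.comp (Subgroup.inclusion hK)) k)) ≤ 𝔮.asIdeal := by
  rw [Set.mem_setOf_eq, iSup_le_iff]
  constructor
  · intro h k
    have hk : ((Subgroup.inclusion hK k : I) : G) ∈ inertiaSubgroup σ ((X.fromSpecStalk x).base 𝔮) :=
      h k.2
    rw [mem_inertiaSubgroup_fromSpecStalk_iff_of_action σ x a τ hkey hτ 𝔮] at hk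
    rw [augIdeal_def, Ideal.span_le]
    rintro _ ⟨r, rfl⟩
    exact hk r
  · intro h k hk
    have h' := h ⟨k, hk⟩
    have hmem : ((Subgroup.inclusion hK ⟨k, hk⟩ : I) : G) ∈
        inertiaSubgroup σ ((X.fromSpecStalk x).base 𝔮) := by
      rw [mem_inertiaSubgroup_fromSpecStalk_iff_of_action σ x a τ hkey hτ 𝔮]
      intro r
      exact h' (sub_mem_augIdeal _ r)
    exact hmem

/-- At the closed point: `x ∈ Z_K ↔ 𝔞_K ≤ 𝔪_x` — in particular the stalk action of a subgroup of the
inertia group `I_x` is residue-trivial. [folklore] -/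
theorem mem_inertLocus_iff_iSup_augIdeal_le :
    x ∈ {y : X | K ≤ inertiaSubgroup σ y} ↔
      (⨆ k : K, augIdeal ((τ.comp (Subgroup.inclusion hK)) k)) ≤ maximalIdeal (X.presheaf.stalk x) := by
  have h := fromSpecStalk_mem_inertLocus_iff σ x a τ hkey hτ hK (closedPoint (X.presheaf.stalk x))
  rw [Scheme.fromSpecStalk_closedPoint] at h
  exact h

/-- **The stalk of the reduced inert locus is the radical of the fixed-locus ideal**: for `Z_K = {y | K ≤ I_y}`
closed, `(𝓘_{Z_K})_x = √(⨆_{k ∈ K} I_{τ k})` in `𝒪_{X,x}` — both are the intersection of the primes `𝔮` of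
`𝒪_{X,x}` whose point `ι_x(𝔮)` lies in `Z_K`. [folklore] -/
theorem stalkIdeal_vanishingIdeal_inertLocus (hZ : IsClosed {y : X | K ≤ inertiaSubgroup σ y}) :
    stalkIdeal (Scheme.IdealSheafData.vanishingIdeal ⟨{y : X | K ≤ inertiaSubgroup σ y}, hZ⟩) x =
      (⨆ k : K, augIdeal ((τ.comp (Subgroup.inclusion hK)) k)).radical := by
  set Z : Closeds X := ⟨{y : X | K ≤ inertiaSubgroup σ y}, hZ⟩ with hZdef
  set J := stalkIdeal (Scheme.IdealSheafData.vanishingIdeal Z) x with hJ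
  set A := ⨆ k : K, augIdeal ((τ.comp (Subgroup.inclusion hK)) k) with hA
  -- the vanishing ideal sheaf is radical, hence so is its stalk
  have hsupp : (Scheme.IdealSheafData.vanishingIdeal Z).support = Z :=
    TopologicalSpace.Closeds.ext (Scheme.IdealSheafData.coe_support_vanishingIdeal (Z := Z))
  have hrad : (Scheme.IdealSheafData.vanishingIdeal Z).radical = Scheme.IdealSheafData.vanishingIdeal Z := by
    rw [← Scheme.IdealSheafData.vanishingIdeal_support, hsupp]
  have hJrad : J.radical = J := by
    rw [hJ, ← stalkIdeal_radical, hrad]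
  -- both `J` and `A` lie in exactly the primes `𝔮` with `ι_x(𝔮) ∈ Z`
  have hiff : ∀ 𝔮 : Spec (X.presheaf.stalk x), J ≤ 𝔮.asIdeal ↔ A ≤ 𝔮.asIdeal := by
    intro 𝔮
    rw [hJ, ← fromSpecStalk_mem_iff_stalkIdeal_vanishingIdeal_le x Z 𝔮]
    exact fromSpecStalk_mem_inertLocus_iff σ x a τ hkey hτ hK 𝔮
  have hsets : {P : Ideal (X.presheaf.stalk x) | J ≤ P ∧ P.IsPrime} =
      {P : Ideal (X.presheaf.stalk x) | A ≤ P ∧ P.IsPrime} := by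
    ext P
    constructor
    · rintro ⟨hP, hPp⟩
      exact ⟨(hiff ⟨P, hPp⟩).mp hP, hPp⟩
    · rintro ⟨hP, hPp⟩
      exact ⟨(hiff ⟨P, hPp⟩).mpr hP, hPp⟩
  rw [← hJrad, Ideal.radical_eq_sInf, Ideal.radical_eq_sInf, hsets]

end InertLocus

/-! ## Tame subgroups on regular stalks: the reduced inert locus is a regular centre with stalk `𝔞_K` -/

section Tame

variable (a : I → (X.presheaf.stalk x ⟶ X.presheaf.stalk x))
  (τ : I →* (X.presheaf.stalk x ≃+* X.presheaf.stalk x))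
  (hkey : ∀ g : I, Spec.map (a g) ≫ X.fromSpecStalk x = X.fromSpecStalk x ≫ (σ (g : G)).hom)
  (hτ : ∀ (g : I) (r : X.presheaf.stalk x), τ g r = (a g⁻¹).hom r)
  {K : Subgroup G} (hK : K ≤ I) [Finite K] [IsRegularLocalRing (X.presheaf.stalk x)]

include hkey hτ hK

/-- **Tame case, on the nose**: if `𝒪_{X,x}` is a regular local ring, `|K|` is invertible in it and `x ∈ Z_K`
(`K ≤ I_x`), then `(𝓘_{Z_K})_x = ⨆_{k ∈ K} I_{τ k}` — the fixed-locus ideal of ✓`TameFixedLocus` is prime (its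
quotient is a regular local ring), hence radical. [folklore] -/
theorem stalkIdeal_vanishingIdeal_inertLocus_of_isUnit
    (hKu : IsUnit ((Nat.card K : ℕ) : X.presheaf.stalk x))
    (hx : K ≤ inertiaSubgroup σ x) (hZ : IsClosed {y : X | K ≤ inertiaSubgroup σ y}) :
    stalkIdeal (Scheme.IdealSheafData.vanishingIdeal ⟨{y : X | K ≤ inertiaSubgroup σ y}, hZ⟩) x =
      ⨆ k : K, augIdeal ((τ.comp (Subgroup.inclusion hK)) k) := by
  have hm : (⨆ k : K, augIdeal ((τ.comp (Subgroup.inclusion hK)) k)) ≤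
      maximalIdeal (X.presheaf.stalk x) :=
    (mem_inertLocus_iff_iSup_augIdeal_le σ x a τ hkey hτ hK).mp hx
  have hreg : IsRegularLocalRing
      (X.presheaf.stalk x ⧸ ⨆ k : K, augIdeal ((τ.comp (Subgroup.inclusion hK)) k)) :=
    TameFixedLocus.isRegularLocalRing_quotient_iSup_augIdeal (τ.comp (Subgroup.inclusion hK)) hKu hm
  haveI := hreg
  haveI : IsDomain
      (X.presheaf.stalk x ⧸ ⨆ k : K, augIdeal ((τ.comp (Subgroup.inclusion hK)) k)) :=
    isDomain_of_isRegularLocalRing _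
  have hprime : (⨆ k : K, augIdeal ((τ.comp (Subgroup.inclusion hK)) k)).IsPrime :=
    (Ideal.Quotient.isDomain_iff_prime _).mp this
  rw [stalkIdeal_vanishingIdeal_inertLocus σ x a τ hkey hτ hK hZ, hprime.radical]

/-- **The reduced inert locus of a tame subgroup is a regular centre at `x`**: under the same hypotheses
`𝒪_{X,x} ⧸ (𝓘_{Z_K})_x` is a regular local ring (✓`TameFixedLocus.isRegularLocalRing_quotient_iSup_augIdeal`).
[folklore] -/
theorem isRegularLocalRing_quotient_stalkIdeal_inertLocus
    (hKu : IsUnit ((Nat.card K : ℕ) : X.presheaf.stalk x))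
    (hx : K ≤ inertiaSubgroup σ x) (hZ : IsClosed {y : X | K ≤ inertiaSubgroup σ y}) :
    IsRegularLocalRing (X.presheaf.stalk x ⧸
      stalkIdeal (Scheme.IdealSheafData.vanishingIdeal ⟨{y : X | K ≤ inertiaSubgroup σ y}, hZ⟩) x) := by
  have hm : (⨆ k : K, augIdeal ((τ.comp (Subgroup.inclusion hK)) k)) ≤
      maximalIdeal (X.presheaf.stalk x) :=
    (mem_inertLocus_iff_iSup_augIdeal_le σ x a τ hkey hτ hK).mp hx
  rw [stalkIdeal_vanishingIdeal_inertLocus_of_isUnit σ x a τ hkey hτ hK hKu hx hZ]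
  exact TameFixedLocus.isRegularLocalRing_quotient_iSup_augIdeal (τ.comp (Subgroup.inclusion hK)) hKu hm

end Tame

end Summit.ResolutionOfSingularities.ResolutionOfSingularities.Theorems.WildQuotientResolution.InertLocusStalk

end
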